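import Literature.Probability.Percolation.PivotalLowerBoundFromSeparation
import Literature.Probability.Percolation.NearCriticalFourArmQuasiMult
import Literature.Probability.Percolation.TruncCorrLengthExponentFromFacts
import Literature.Probability.Percolation.WernerKestenRelationFromTwoFacts
import HarnessLib

/-!
# Kesten's scaling relation from near-critical four-arm separation (assembly, proofs only)

Topic `Literature/Probability/Percolation`; family `crit-perc`. PROOFS ONLY (no definition, no
named fact): the state of the discharge of the named fact `Nolin2008_prop34`
(`KestenScaling.lean`; P. Nolin, *Near-critical percolation in two dimensions*, EJP 13 (2008),
§7.3, Prop. 34 [arXiv 0711.4948: Prop. 32]: "for any fixed `ε ∈ (0, 1/2)`,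
`|p - 1/2| L_ε(p)² π₄(L_ε(p)) ≍ 1`"; H. Kesten, *Comm. Math. Phys.* 109 (1987), (4.5); W. Werner,
*Lectures on two-dimensional critical percolation*, PCMI 2009, Lecture 6, display after Lemma 6.3)
and of its Werner-length twin `Werner2009_kestenRelationW` (`WernerCorrelationLength.lean`).

The tree proves Kesten's relation from the two remaining named facts of the near-critical arm
calculus, `Werner2009_fourArm_quasiMult` (Werner's Cor. 6.2) and `Werner2009_pivotal_lowerBound`
(proof of Lemma 6.2, interior points): `Nolin2008_prop34_of_facts₂`
(`TruncCorrLengthExponentFromFacts.lean`), `Werner2009_kestenRelationW_of_facts2`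
(`WernerKestenRelationFromTwoFacts.lean`). Both facts are now theorems CONDITIONAL ON ONE INPUT,
stated as an explicit hypothesis: the comparability, uniformly below Werner's length
`L(p, ε) = charLengthW ε p`, of the well-separated four-arm event with alternating colours
`sepFourArm n N` (`ArmSeparationFourArm.lean`) with the four-arm event —
`c · π̂_t(n, N) ≤ P_t(sepFourArm n N)` for `n₀ ≤ n`, `2n ≤ N`, `N ≤ L(t, ε)` if `t > 1/2`,
`t ∈ [1/2, 1/2 + δ)` (Nolin 2008, Thm. 11 [arXiv Thm. 10], `j = 4`, near-critical, after Kesten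
1987, Lemmas 4–6; with the comparability of the adjacent colour arrangement also contained in the
order-free `armEvent ![T,F,T,F]`, Nolin Prop. 20 and Thm. 27):
`Werner2009_fourArm_quasiMult_of_separation` (`NearCriticalFourArmQuasiMult.lean`) and
`Werner2009_pivotal_lowerBound_of_separation` (`PivotalLowerBoundFromSeparation.lean`). Hence
(this file):

* `Werner2009_lemma62P_of_separation`, `Werner2009_lemma63_of_separation`,
  `Werner2009_lemma62W_of_separation` — Werner's Lemma 6.2 (pivotal count), Lemma 6.3 (four-arm
  stability) and Lemma 6.2 at Werner's length, from near-critical four-arm separation;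
* `Werner2009_kestenRelationW_of_separation`, `Nolin2008_prop34_of_separation` — **Kesten's
  scaling relation `(p - 1/2) L(p)² π₄(L(p)) ≍ 1`, in Werner's and in Nolin's normalisation,
  follows from near-critical four-arm separation alone**;
* `SmirnovWerner2001_truncCorrLength_exponent_of_separation` — with the four-arm exponent,
  `ξ*(p) = |p - 1/2|^{-4/3 + o(1)}`.

The discharge `Nolin2008_prop34_holds` is `Nolin2008_prop34_of_separation` applied to the
near-critical separation theorem once the arm-separation programme (`ArmSeparation*.lean`, Nolin's
Thm. 11) reaches `j = 4` below `L(p)`; the hypothesis is the `t`-uniform version of the one consumed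
at `p = 1/2` by `critFourArmProb_quasiMult_of_separation` / `fourArm_exponent_of_separation`
(`ArmSeparationFourArmProofs.lean`), so that one separation theorem serves the four-arm exponent,
Kesten's relation and everything downstream (`triTheta_exponent`, the correlation-length and
mean-cluster-size exponents).

## References

* P. Nolin, Near-critical percolation in two dimensions, *Electron. J. Probab.* 13 (2008), §7.3,
  Prop. 34; Thm. 11, Prop. 12, Lemma 13, Prop. 17, Rem. 9 (arXiv 0711.4948: Prop. 32; Thm. 10,
  Prop. 11, Lemma 12, Prop. 16, Rem. 8) [Nolin2008].
* W. Werner, *Lectures on two-dimensional critical percolation*, IAS/Park City Math. Ser. 16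
  (2009), Lecture 6, Prop. 6.1, Cor. 6.2, Lemma 6.2, Cor. 6.3, Lemma 6.3 [WernerPCMI2009].
* H. Kesten, Scaling relations for 2D-percolation, *Comm. Math. Phys.* 109 (1987), (4.5) and
  Lemmas 4–6, 8 [KestenScalingCMP1987].
* S. Smirnov, W. Werner, Critical exponents for two-dimensional percolation, *Math. Res. Lett.* 8
  (2001), Thm. 1 (iv) [SmirnovWernerMRL2001].

Tree: `Nolin2008_prop34_of_facts₂`, `SmirnovWerner2001_truncCorrLength_exponent_of_facts₃`
(`TruncCorrLengthExponentFromFacts.lean`), `Werner2009_lemma62P_of_facts2`,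
`Werner2009_lemma63_of_facts2`, `Werner2009_lemma62W_of_facts2`,
`Werner2009_kestenRelationW_of_facts2` (`WernerKestenRelationFromTwoFacts.lean`),
`Werner2009_fourArm_quasiMult_of_separation` (`NearCriticalFourArmQuasiMult.lean`),
`Werner2009_pivotal_lowerBound_of_separation` (`PivotalLowerBoundFromSeparation.lean`).
-/

noncomputable section

namespace Literature.Probability.Percolation

/-- **Lemma 6.2 (pivotal count, `d/dp h_p(n) ≍ n² π̂_p(n)` uniformly for `n ≤ L(p)`) from
near-critical four-arm separation** (Werner 2009, Lecture 6, Lemma 6.2):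
`Werner2009_lemma62P_of_facts2` with `Werner2009_fourArm_quasiMult_of_separation` and
`Werner2009_pivotal_lowerBound_of_separation`. [cite: WernerPCMI2009, Lecture 6, Lemma 6.2] [cite: Nolin2008, Thm. 11 and Prop. 12 (arXiv 0711.4948: Thm. 10, Prop. 11)] -/
theorem Werner2009_lemma62P_of_separation
    (hsep : ∃ ε₁ > (0 : ℝ), ∀ ⦃ε : ℝ⦄, 0 < ε → ε < ε₁ →
      ∃ n₀ : ℕ, ∃ δ > (0 : ℝ), ∃ c > (0 : ℝ),
        ∀ t : unitInterval, 1 / 2 ≤ (t : ℝ) → (t : ℝ) < 1 / 2 + δ →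
          ∀ n N : ℕ, n₀ ≤ n → 2 * n ≤ N → (1 / 2 < (t : ℝ) → N ≤ charLengthW ε t) →
            c * fourArmProbAt t n N ≤ (LatticeModels.triSitePercolation t).real (sepFourArm n N)) :
    Werner2009_lemma62P :=
  Werner2009_lemma62P_of_facts2 (Werner2009_fourArm_quasiMult_of_separation hsep)
    (Werner2009_pivotal_lowerBound_of_separation hsep)

/-- **Lemma 6.3 (four-arm stability, `π̂_{p'}(n) ≍ π̂_{1/2}(n)` uniformly for `n ≤ L(p)`) from
near-critical four-arm separation** (Werner 2009, Lecture 6, Lemma 6.3):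
`Werner2009_lemma63_of_facts2` with the two separation consequences. [cite: WernerPCMI2009, Lecture 6, Lemma 6.3] [cite: Nolin2008, Thm. 11 and Thm. 27 (arXiv 0711.4948: Thm. 10, Thm. 26)] -/
theorem Werner2009_lemma63_of_separation
    (hsep : ∃ ε₁ > (0 : ℝ), ∀ ⦃ε : ℝ⦄, 0 < ε → ε < ε₁ →
      ∃ n₀ : ℕ, ∃ δ > (0 : ℝ), ∃ c > (0 : ℝ),
        ∀ t : unitInterval, 1 / 2 ≤ (t : ℝ) → (t : ℝ) < 1 / 2 + δ →
          ∀ n N : ℕ, n₀ ≤ n → 2 * n ≤ N → (1 / 2 < (t : ℝ) → N ≤ charLengthW ε t) →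
            c * fourArmProbAt t n N ≤ (LatticeModels.triSitePercolation t).real (sepFourArm n N)) :
    Werner2009_lemma63 :=
  Werner2009_lemma63_of_facts2 (Werner2009_fourArm_quasiMult_of_separation hsep)
    (Werner2009_pivotal_lowerBound_of_separation hsep)

/-- **Lemma 6.2 at Werner's length (`Werner2009_lemma62W`) from near-critical four-arm
separation** (Werner 2009, Lecture 6, Lemma 6.2 with Lemma 6.3): `Werner2009_lemma62W_of_facts2`
with the two separation consequences. [cite: WernerPCMI2009, Lecture 6, Lemma 6.2 and Lemma 6.3] -/
theorem Werner2009_lemma62W_of_separation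
    (hsep : ∃ ε₁ > (0 : ℝ), ∀ ⦃ε : ℝ⦄, 0 < ε → ε < ε₁ →
      ∃ n₀ : ℕ, ∃ δ > (0 : ℝ), ∃ c > (0 : ℝ),
        ∀ t : unitInterval, 1 / 2 ≤ (t : ℝ) → (t : ℝ) < 1 / 2 + δ →
          ∀ n N : ℕ, n₀ ≤ n → 2 * n ≤ N → (1 / 2 < (t : ℝ) → N ≤ charLengthW ε t) →
            c * fourArmProbAt t n N ≤ (LatticeModels.triSitePercolation t).real (sepFourArm n N)) :
    Werner2009_lemma62W :=
  Werner2009_lemma62W_of_facts2 (Werner2009_fourArm_quasiMult_of_separation hsep)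
    (Werner2009_pivotal_lowerBound_of_separation hsep)

/-- **Kesten's scaling relation at Werner's length, `(p - 1/2) · L(p)² · π₄(L(p)) ≍ 1`
(`Werner2009_kestenRelationW`), from near-critical four-arm separation** (Werner 2009, Lecture 6,
display after Lemma 6.3: "`L(p₀)² × π̂_{1/2}(L(p₀)) ≍ (p₀ - 1/2)⁻¹`", from Cor. 6.3 and Lemma 6.3;
Kesten 1987): `Werner2009_kestenRelationW_of_facts2` with
`Werner2009_fourArm_quasiMult_of_separation` and `Werner2009_pivotal_lowerBound_of_separation`.
The discharge `Werner2009_kestenRelationW_holds` is this theorem applied to the near-critical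
four-arm separation theorem (Nolin's Thm. 11, `j = 4`, below `L(p)`) once it lands. [cite: WernerPCMI2009, Lecture 6, Cor. 6.3, Lemma 6.3 and the display following Lemma 6.3 (arXiv 0710.0856, p. 47)] [cite: KestenScalingCMP1987, (4.5)] [cite: Nolin2008, Thm. 11 (arXiv 0711.4948: Thm. 10)] -/
theorem Werner2009_kestenRelationW_of_separation
    (hsep : ∃ ε₁ > (0 : ℝ), ∀ ⦃ε : ℝ⦄, 0 < ε → ε < ε₁ →
      ∃ n₀ : ℕ, ∃ δ > (0 : ℝ), ∃ c > (0 : ℝ),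
        ∀ t : unitInterval, 1 / 2 ≤ (t : ℝ) → (t : ℝ) < 1 / 2 + δ →
          ∀ n N : ℕ, n₀ ≤ n → 2 * n ≤ N → (1 / 2 < (t : ℝ) → N ≤ charLengthW ε t) →
            c * fourArmProbAt t n N ≤ (LatticeModels.triSitePercolation t).real (sepFourArm n N)) :
    Werner2009_kestenRelationW :=
  Werner2009_kestenRelationW_of_facts2 (Werner2009_fourArm_quasiMult_of_separation hsep)
    (Werner2009_pivotal_lowerBound_of_separation hsep)

/-- **Kesten's scaling relation `|p - 1/2| · L_ε(p)² · π₄(L_ε(p)) ≍ 1` (`Nolin2008_prop34`) from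
near-critical four-arm separation** (Nolin 2008, §7.3, Prop. 34 [arXiv 0711.4948: Prop. 32]:
"for any fixed `ε ∈ (0, 1/2)`, `|p - 1/2| L_ε(p)² π₄(L_ε(p)) ≍ 1`"; Kesten 1987, (4.5); Werner 2009,
Lecture 6, display after Lemma 6.3): `Nolin2008_prop34_of_facts₂` with
`Werner2009_fourArm_quasiMult_of_separation` and `Werner2009_pivotal_lowerBound_of_separation`.
IF the well-separated four-arm event with alternating colours is comparable to the four-arm event
uniformly below Werner's length — `c · π̂_t(n, N) ≤ P_t(sepFourArm n N)` for `n₀ ≤ n`,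
`2n ≤ N ≤ L(t, ε)` (`t ∈ [1/2, 1/2 + δ)`; Nolin's arm-separation Thm. 11 [arXiv Thm. 10] for
`j = 4` below `L(p)`, after Kesten 1987, Lemmas 4–6) — THEN `Nolin2008_prop34` holds. The discharge
`Nolin2008_prop34_holds` is this theorem applied to that separation theorem once it lands; no other
input is missing. [cite: Nolin2008, §7.3, Prop. 34 (arXiv 0711.4948: Prop. 32), with Thm. 11, Prop. 12, Prop. 17 and Rem. 9 (arXiv: Thm. 10, Prop. 11, Prop. 16, Rem. 8)] [cite: KestenScalingCMP1987, (4.5)] [cite: WernerPCMI2009, Lecture 6, Cor. 6.2, Lemma 6.2, Cor. 6.3, Lemma 6.3] -/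
theorem Nolin2008_prop34_of_separation
    (hsep : ∃ ε₁ > (0 : ℝ), ∀ ⦃ε : ℝ⦄, 0 < ε → ε < ε₁ →
      ∃ n₀ : ℕ, ∃ δ > (0 : ℝ), ∃ c > (0 : ℝ),
        ∀ t : unitInterval, 1 / 2 ≤ (t : ℝ) → (t : ℝ) < 1 / 2 + δ →
          ∀ n N : ℕ, n₀ ≤ n → 2 * n ≤ N → (1 / 2 < (t : ℝ) → N ≤ charLengthW ε t) →
            c * fourArmProbAt t n N ≤ (LatticeModels.triSitePercolation t).real (sepFourArm n N)) :
    Nolin2008_prop34 :=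
  Nolin2008_prop34_of_facts₂ (Werner2009_fourArm_quasiMult_of_separation hsep)
    (Werner2009_pivotal_lowerBound_of_separation hsep)

/-- **Smirnov–Werner's Thm. 1 (iv), `ξ*(p) = |p - 1/2|^{-4/3+o(1)}`, from the four-arm exponent and
near-critical four-arm separation** (`SmirnovWerner2001_truncCorrLength_exponent_of_facts₃` with the
two separation consequences). [cite: SmirnovWernerMRL2001, §2 Thm. 1 (iv) and the paragraph following Thm. 1] [cite: Nolin2008, §7.3 Prop. 34, §7.4 Lemma 39 (arXiv 0711.4948: Prop. 32, Lemma 37)] -/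
theorem SmirnovWerner2001_truncCorrLength_exponent_of_separation (h₄ : fourArm_exponent)
    (hsep : ∃ ε₁ > (0 : ℝ), ∀ ⦃ε : ℝ⦄, 0 < ε → ε < ε₁ →
      ∃ n₀ : ℕ, ∃ δ > (0 : ℝ), ∃ c > (0 : ℝ),
        ∀ t : unitInterval, 1 / 2 ≤ (t : ℝ) → (t : ℝ) < 1 / 2 + δ →
          ∀ n N : ℕ, n₀ ≤ n → 2 * n ≤ N → (1 / 2 < (t : ℝ) → N ≤ charLengthW ε t) →
            c * fourArmProbAt t n N ≤ (LatticeModels.triSitePercolation t).real (sepFourArm n N)) :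
    SmirnovWerner2001_truncCorrLength_exponent :=
  SmirnovWerner2001_truncCorrLength_exponent_of_facts₃ h₄ (Werner2009_fourArm_quasiMult_of_separation hsep)
    (Werner2009_pivotal_lowerBound_of_separation hsep)

end Literature.Probability.Percolation
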